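import Mathlib
import Literature.NumberTheory.Transcendental.ZagierDilogarithmConjecture
import Literature.NumberTheory.Transcendental.BlochWignerDilogarithm
import Summits.KontsevichZagierPeriods.KontsevichZagierPeriods.Theorems.HyperbolicBlochZagierDilogarithmConjectureStubCyclotomicSectorIffMilnor
import HarnessLib

/-!
# `ZagierDilogarithmConjecture` (stmt-KontsevichZagierPeriods-10550) — line `kummer-clausen-linearisation`
(c5 cycle 3, "corollaries of the sector calculus"), stub `stub_milnor_antitone`

**Milnor's conjecture is ANTITONE in the level: if `N ∣ M`, then Milnor's conjecture for `M` implies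
Milnor's conjecture for `N` — unconditionally.** Write `ζ_N = e^{2πi/N}`, `D` for the Bloch–Wigner
dilogarithm (`blochWignerDilog`) and `⟨dilogRelators⟩ ⊆ ℤ[ℂ]` for the relator group of Zagier's
dilogarithm conjecture (Neumann 1998, §2.1). `Milnor_N` (Milnor 1982, Appendix, `ℤ`-form) says that the
primitive Clausen values `D(ζ_N^c)`, `(c, N) = 1`, `0 < c < N/2`, admit only the trivial `ℤ`-relation.

**Theorem.** For all `N, M ≥ 1` with `N ∣ M`: `Milnor_M → Milnor_N`.

Proof. By the landed `stub_cyclotomicSector_iff_milnor` (for every level `L`, `Milnor_L` is equivalent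
to the level-`L` cyclotomic sector of Zagier's conjecture in torsion form: every `ℤ`-relation
`Σᵢ nᵢ D(uᵢ) = 0` among `L`-th roots of unity `uᵢ` of the open upper half plane has a positive multiple
of `Σᵢ nᵢ [uᵢ]` in `⟨dilogRelators⟩`), `Milnor_M` gives the level-`M` sector; the level-`M` sector
contains the level-`N` sector, since `u ^ N = 1` and `M = N · d` give `u ^ M = (u ^ N) ^ d = 1`; and the
level-`N` sector is `Milnor_N`. Classically this monotonicity of Milnor's conjecture in the level is
deduced from Bass' theorem on the universal (odd) distribution; here it is free from the sector
calculus of this line. Sorry-free; axioms ⊆ {propext, Classical.choice, Quot.sound}.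

## References

* W. D. Neumann, *Hilbert's 3rd problem and invariants of 3-manifolds*, Geom. Topol. Monogr. 1 (1998),
  §2.1. [Neumann1998]
* J. Milnor, *Hyperbolic geometry: the first 150 years*, Bull. AMS 6 (1982), Appendix (the conjecture
  on the values `Л(πc/N)`). [Milnor1982]
-/

noncomputable section

open scoped BigOperators ComplexConjugate
open Literature.NumberTheory.Transcendental

namespace Summit.KontsevichZagierPeriods.HyperbolicBloch.ZagierDilogarithmCyclotomic

/-- **Stub `stub_milnor_antitone` (c5 cycle 3): Milnor's conjecture is ANTITONE in the level.** If
`N ∣ M` (`N, M ≥ 1`) and the primitive level-`M` Clausen values `D(ζ_M^c)`, `c ∈ (ℤ/M)ˣ`,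
`0 < c < M/2`, are `ℤ`-linearly independent (Milnor_M), then so are the primitive level-`N` values
`D(ζ_N^c)`, `c ∈ (ℤ/N)ˣ`, `0 < c < N/2` (Milnor_N). By `stub_cyclotomicSector_iff_milnor`, Milnor_M is
the level-`M` cyclotomic sector (torsion form) of Zagier's conjecture, which contains the level-`N`
sector (`u ^ N = 1 → u ^ M = 1` as `N ∣ M`), which is Milnor_N. Classically this needs Bass' theorem on
the universal odd distribution; here it is free from the sector calculus.
[cite: Milnor1982, Appendix] -/
theorem stub_milnor_antitone :
    ∀ (N M : ℕ) [NeZero N] [NeZero M], N ∣ M →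
      (∀ m : ZMod M → ℤ, (∀ c, m c ≠ 0 → IsUnit c ∧ 0 < c.val ∧ 2 * c.val < M) →
          ∑ c : ZMod M, (m c : ℝ) *
              blochWignerDilog (Complex.exp (2 * Real.pi * Complex.I / M) ^ c.val) = 0 →
            ∀ c, m c = 0) →
        ∀ m : ZMod N → ℤ, (∀ c, m c ≠ 0 → IsUnit c ∧ 0 < c.val ∧ 2 * c.val < N) →
          ∑ c : ZMod N, (m c : ℝ) *
              blochWignerDilog (Complex.exp (2 * Real.pi * Complex.I / N) ^ c.val) = 0 →
            ∀ c, m c = 0 := by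
  intro N M _ _ hdvd hM
  refine (stub_cyclotomicSector_iff_milnor N).1 fun k u n hu him hsum =>
    (stub_cyclotomicSector_iff_milnor M).2 hM k u n (fun i => ?_) him hsum
  obtain ⟨d, hd⟩ := hdvd
  rw [hd, pow_mul, hu, one_pow]

end Summit.KontsevichZagierPeriods.HyperbolicBloch.ZagierDilogarithmCyclotomic

end
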